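import Summits.QuantumFields.BalabanUV.Beta.GAN24.AxProjBmWindow
import Summits.QuantumFields.BalabanUV.Beta.GAN24.KernelLegCharges

/-!
# `BalabanUV.Beta.GAN24.PiBmConstants` — binder row G-an2-4 / (CONV-C), S-slot on the literal of record (family (E), road «SREC»):
# `Π_bm` DOES NOT FIX CONSTANTS — the block-mean-normalised rooted projector on a translation-invariant 1-form is `N` times the
# indicator of the bonds crossing a block face, the ROW sums of its matrix, and the field–field double-leg total of a dressed table

NOT IN PRINT; OUR BOOKKEEPING (idle-seat piece «SREC-PICONST» = RULINGS-16 (R16-1) of the row owner `b2b-balaban-gan24-p1` gen 13 — the located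
correction (C1) to SKELETON-SREC v0.2 (Z-b), journal l.18293; claimed by the road-P4 custody lineage `b2b-balaban-gan24-p4` gen 27, delivered gen 28).
HONEST FRAMING (cell contract, verbatim): «discharging `BetaPertH` makes Bałaban's UV stability UNCONDITIONAL — a real constructive-QFT result;
it is NOT the continuum limit and NOT the Clay problem.»  HONEST DEPENDENCY (verbatim): «continuum YM on T⁴ ⇐ BetaPertH ∧ nine spine estimates
(0/9 proved); BetaPertH ⇐ (D1) ∧ (D4) ∧ CAP+tail; G-an2-4 gates asym, D1 and NE2/3/4.»  [folklore] lattice bookkeeping over an2's block-mean dressing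
objects BY NAME (`blockMeanAt`, `axProjBmAt`, `axProjBmAt_dz`, `pmBm`, `cube`, `window_of_pmBm_ne_zero`, `abs_pmBm_le`, `coProjBmW`, `coProjBmAt`, `dressKBmAt`,
`dressKBmAt_eq_legs`), the lead's `dz` ∕ `blockSum` ∕ `blk` ∕ `AffineReproduction.dz_linear`, gen 27's `AxProjBmWindow.axProjBmAt_eq_coProjBmW'`, leaf-06's
`KernelLegCharges.summable_prod_of_biLoc`; generic dimension; NO estimate, NO cited fact, NO `def`, NO `def … : Prop`, NO wall binder; reserved families
untouched.  Discharges NOTHING of (hS, hSall) on (E); NOT D1, NOT BetaPertH, NOT continuum, NOT Clay.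

## The finding (kernel-checked below; `ρ = toSite r`, `r ∈ box`, `1 ≤ N`)
`Πᵀ_bm` fixes constants (`SrecChargeBm.coProjBmAt_const`, Kronecker COLUMN sums `tsum_pmBm_col`) and `Π_bm` preserves TOTALS (`tsum_coProjBmW`) — but
`Π_bm` of a constant 1-form is NOT that 1-form:
* §1 `sum_box_coord`, `blockMeanAt_linear`, **`blockMeanAt_coord`**: `blockMeanAt N (x ↦ x_α) x = N·(blk N x)_α + (N−1)∕2` (box reflection `b_α ↦ N−1−b_α`).
* §2 `int_succ_ediv` ∕ `blk_add_unitVec_apply` (`blk N (x + e_κ) = blk N x + [x_κ % N = N−1]·e_κ`), **`axProjBmAt_const_eq_dz`**: `Π^ρ_bm (κ ↦ c κ) =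
  dz (x ↦ N·Σ_α (blk N x)_α·c α)` for ANY root (`axProjBmAt_dz` on `dz_linear`, §1; the additive constant dies under `dz`), hence **`axProjBmAt_const`**:
  `Π^ρ_bm (κ ↦ c κ) = (κ, x) ↦ if x_κ % N = N−1 then N·c κ else 0` — `N` TIMES THE INDICATOR OF THE BONDS CROSSING A BLOCK FACE — and `coProjBmW_const`
  (window-matrix form, in-block root).
* §3 ROW SUMS OF THE MATRIX OF `Π_bm` (in-block root): `sum_cube_sum_pmBm_row` (`Σ_{v ∈ cube} Σ_α pmBm ρ N β p α (p − v)·c α = [p_β % N = N−1]·N·c β`),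
  `sum_cube_pmBm_row` ∕ **`tsum_pmBm_row`** (`Σ'_q pmBm ρ N β p α q = [β = α ∧ p_β % N = N−1]·N` — contrast the Kronecker column sums), and the transposed
  read-out `sum_cube_sum_pmBm_col_mul` used by §4.
* §4 THE FIELD–FIELD DOUBLE-LEG TOTAL OF A DRESSED TABLE (in-block root): `dressKBmAt_inl_inl_eq_sum` (window form of `Πᵀ X Π` on field legs),
  `summable_prod_dressKBmAt_inl_inl`, **`tsum_prod_dressKBmAt_inl_inl`**: for a table `X` with summable field–field pair sums,
  `Σ'_{(x,z)} dressKBmAt ρ N X x z (inl α)(inl β) = N²·Σ'_{(x,z)} [x_α % N = N−1 ∧ z_β % N = N−1]·X x z (inl α)(inl β)` — the dressing does NOT preserve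
  the double-leg total (it reads `X` on the face-crossing bond pairs only, weighted `N²`); `…_of_biLoc` is the `BiLoc` instance.
Unit `b2b-balaban-gan24-p4` (road P4 seat in custody, gen 28, inheriting gen 27's claim), 2026-08-20.
-/

noncomputable section

open Finset
open scoped BigOperators
open Literature.MathematicalPhysics.QuantumFieldTheory
open Literature.MathematicalPhysics.QuantumFieldTheory.Balaban1983to89
open Literature.MathematicalPhysics.QuantumFieldTheory.Balaban1983to89.Beta
open ExpKernelCalculus (MKer BiLoc)
open AffineAveraging (Form0 Form1 Site box toSite unitVec unitVec_apply dz blockSum)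
open AffineReproduction (dz_linear dz_add dz_const)
open AveragingContours (blk)
open OneStepResolventKernel (Fib)
open Summit.QuantumFields.BalabanUV.Beta.AxialProjectorBlockMean (blockMeanAt axProjBmAt)
open Summit.QuantumFields.BalabanUV.Beta.AxialDressingRooted (pmBm cube mem_cube window_of_pmBm_ne_zero abs_pmBm_le coProjBmW coProjBmW_apply
  coProjBmAt coProjBmAt_apply dressKBmAt dressKBmAt_eq_legs legCo₁BmAt_inl legCo₂BmAt_inl)
open Summit.QuantumFields.BalabanUV.Beta.BorderedHessian (axProjBmAt_dz)
open Summit.QuantumFields.BalabanUV.Beta.GAN24.AxProjBmWindow (axProjBmAt_eq_coProjBmW')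
open Summit.QuantumFields.BalabanUV.Beta.GAN24.KernelLegCharges (summable_prod_of_biLoc)

namespace Summit.QuantumFields.BalabanUV.Beta.GAN24.PiBmConstants

variable {d : ℕ}

/-! ## §1 The block mean of a coordinate function -/

section BlockMean

variable {N : ℕ}

/-- [folklore] **THE ARITHMETIC SUM OVER THE BOX**: `Σ_{b ∈ box} b_α = N^{d+1}·(N−1)∕2` (`1 ≤ N`; the reflection `b_α ↦ N − 1 − b_α` of the box
pairs the summand with `N − 1 −` itself). -/
theorem sum_box_coord (hN : 1 ≤ N) (α : Fin (d + 1)) :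
    ∑ b ∈ box (d + 1) N, ((b α : ℕ) : ℝ) = (N : ℝ) ^ (d + 1) * (((N : ℝ) - 1) / 2) := by
  have hmem : ∀ b ∈ box (d + 1) N, ∀ i, b i < N := fun b hb i => Finset.mem_range.1 (Fintype.mem_piFinset.1 hb i)
  have hcard : (box (d + 1) N).card = N ^ (d + 1) := by simp [AffineAveraging.box, Fintype.card_piFinset]
  -- the reflection of the `α`-th coordinate
  have hσmem : ∀ b ∈ box (d + 1) N, Function.update b α (N - 1 - b α) ∈ box (d + 1) N := by
    intro b hb
    refine Fintype.mem_piFinset.2 fun i => Finset.mem_range.2 ?_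
    by_cases hi : i = α
    · subst hi; rw [Function.update_self]; omega
    · rw [Function.update_of_ne hi]; exact hmem b hb i
  have hσσ : ∀ b ∈ box (d + 1) N, Function.update (Function.update b α (N - 1 - b α)) α (N - 1 - Function.update b α (N - 1 - b α) α) = b := by
    intro b hb
    funext i
    by_cases hi : i = α
    · subst hi; simp only [Function.update_self]; have := hmem b hb i; omega
    · simp only [Function.update_of_ne hi]
  have hrefl : ∑ b ∈ box (d + 1) N, ((b α : ℕ) : ℝ) = ∑ b ∈ box (d + 1) N, ((N : ℝ) - 1 - ((b α : ℕ) : ℝ)) := by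
    refine Finset.sum_nbij' (fun b => Function.update b α (N - 1 - b α)) (fun b => Function.update b α (N - 1 - b α)) hσmem hσmem hσσ hσσ
      fun b hb => ?_
    have h := hmem b hb α
    simp only [Function.update_self]
    rw [Nat.cast_sub (by omega), Nat.cast_sub hN, Nat.cast_one]
    ring
  have h2 : ∑ b ∈ box (d + 1) N, (((b α : ℕ) : ℝ) + ((N : ℝ) - 1 - ((b α : ℕ) : ℝ))) = (N : ℝ) ^ (d + 1) * ((N : ℝ) - 1) := by
    rw [Finset.sum_congr rfl fun b _ => show ((b α : ℕ) : ℝ) + ((N : ℝ) - 1 - ((b α : ℕ) : ℝ)) = (N : ℝ) - 1 by ring, Finset.sum_const,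
      hcard, nsmul_eq_mul]; push_cast; ring
  rw [Finset.sum_add_distrib, ← hrefl] at h2
  linarith

/-- [folklore] The block mean of a LINEAR function: `blockMeanAt N (x ↦ Σ_α x_α·c α) x = Σ_α (N·(blk N x)_α + (N−1)∕2)·c α` (`1 ≤ N`). -/
theorem blockMeanAt_linear (hN : 1 ≤ N) (c : Fin (d + 1) → ℝ) (x : Site (d + 1)) :
    blockMeanAt N (fun y : Site (d + 1) => ∑ α, (y α : ℝ) * c α) x = ∑ α, ((N : ℝ) * (blk N x α : ℝ) + ((N : ℝ) - 1) / 2) * c α := by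
  have hNn : ((N : ℝ) ^ (d + 1)) ≠ 0 := pow_ne_zero _ (by exact_mod_cast (show N ≠ 0 by omega))
  have hcard : (box (d + 1) N).card = N ^ (d + 1) := by simp [AffineAveraging.box, Fintype.card_piFinset]
  unfold blockMeanAt blockSum
  rw [div_eq_iff hNn]
  have e : ∀ b ∈ box (d + 1) N, (fun y : Site (d + 1) => ∑ α, (y α : ℝ) * c α) ((N : ℤ) • blk N x + toSite b)
      = ∑ α, ((N : ℝ) * (blk N x α : ℝ) + ((b α : ℕ) : ℝ)) * c α := fun b _ =>
    Finset.sum_congr rfl fun α _ => by simp only [Pi.add_apply, Pi.smul_apply, smul_eq_mul, toSite]; push_cast; ring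
  rw [Finset.sum_congr rfl e, Finset.sum_comm]
  have e2 : ∀ α : Fin (d + 1), ∑ b ∈ box (d + 1) N, ((N : ℝ) * (blk N x α : ℝ) + ((b α : ℕ) : ℝ)) * c α
      = (((N : ℝ) * (blk N x α : ℝ) + ((N : ℝ) - 1) / 2) * c α) * (N : ℝ) ^ (d + 1) := by
    intro α
    rw [← Finset.sum_mul, Finset.sum_add_distrib, Finset.sum_const, hcard, nsmul_eq_mul, sum_box_coord hN α]; push_cast; ring
  rw [Finset.sum_congr rfl fun α _ => e2 α, ← Finset.sum_mul]

/-- [folklore] **THE BLOCK MEAN OF A COORDINATE FUNCTION**: `blockMeanAt N (x ↦ x_α) x = N·(blk N x)_α + (N−1)∕2` (`1 ≤ N`) — the mean of the `α`-th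
coordinate over the block `{N·b, …, N·b + N − 1}^{d+1}` of `x`. -/
theorem blockMeanAt_coord (hN : 1 ≤ N) (α : Fin (d + 1)) (x : Site (d + 1)) :
    blockMeanAt N (fun y : Site (d + 1) => (y α : ℝ)) x = (N : ℝ) * (blk N x α : ℝ) + ((N : ℝ) - 1) / 2 := by
  have e : (fun y : Site (d + 1) => (y α : ℝ)) = fun y => ∑ α', (y α' : ℝ) * (if α' = α then (1 : ℝ) else 0) := by
    funext y; simp only [mul_ite, mul_one, mul_zero, Finset.sum_ite_eq', Finset.mem_univ, if_true]
  rw [e, blockMeanAt_linear hN]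
  simp only [mul_ite, mul_one, mul_zero, Finset.sum_ite_eq', Finset.mem_univ, if_true]

end BlockMean

/-! ## §2 `Π_bm` on translation-invariant 1-forms: `N` times the indicator of the face-crossing bonds -/

section Constants

variable {N : ℕ}

/-- [folklore] Integer division across one step: `(a + 1) ∕ n = a ∕ n + [a % n = n − 1]` (`0 < n`). -/
theorem int_succ_ediv {n : ℤ} (hn : 0 < n) (a : ℤ) : (a + 1) / n = a / n + (if a % n = n - 1 then 1 else 0) := by
  have e : n * (a / n) + a % n = a := Int.mul_ediv_add_emod a n
  have h0 : 0 ≤ a % n := Int.emod_nonneg a hn.ne'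
  have h1 : a % n < n := Int.emod_lt_of_pos a hn
  by_cases h : a % n = n - 1
  · rw [if_pos h]
    have ha : a + 1 = n * (a / n + 1) := by rw [h] at e; linarith
    rw [ha, Int.mul_ediv_cancel_left _ hn.ne']
  · rw [if_neg h, add_zero]
    have ha : a + 1 = (a % n + 1) + n * (a / n) := by linarith
    rw [ha, Int.add_mul_ediv_left _ _ hn.ne', Int.ediv_eq_zero_of_lt (by omega) (by omega), zero_add]

/-- [folklore] **THE BLOCK INDEX ACROSS ONE BOND**: `blk N (x + e_κ) i = blk N x i + [i = κ ∧ x_κ % N = N − 1]` (`1 ≤ N`) — the bond `(κ, x)` leaves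
the block of `x` iff `x_κ` sits on the upper `κ`-face. -/
theorem blk_add_unitVec_apply (hN : 1 ≤ N) (x : Site (d + 1)) (κ i : Fin (d + 1)) :
    blk N (x + unitVec κ) i = blk N x i + (if i = κ ∧ x κ % (N : ℤ) = (N : ℤ) - 1 then 1 else 0) := by
  have hNpos : (0 : ℤ) < N := by exact_mod_cast hN
  show (x + unitVec κ) i / (N : ℤ) = x i / (N : ℤ) + _
  rw [Pi.add_apply, unitVec_apply]
  by_cases hi : i = κ
  · subst hi
    rw [if_pos rfl, int_succ_ediv hNpos]
    by_cases hf : x i % (N : ℤ) = (N : ℤ) - 1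
    · rw [if_pos hf, if_pos ⟨rfl, hf⟩]
    · rw [if_neg hf, if_neg (fun h => hf h.2)]
  · rw [if_neg hi, if_neg (fun h => hi h.1), add_zero, add_zero]

/-- [folklore] **`Π_bm` ON A TRANSLATION-INVARIANT 1-FORM, OPERATOR FORM** (any root offset `ρ`, `1 ≤ N`):
`Π^ρ_bm (κ ↦ c κ) = dz (x ↦ N·Σ_α (blk N x)_α·c α)` — `N` times the gradient of the BLOCK-CONSTANT lift of the coarse linear function `y ↦ Σ_α y_α c α`
(the constant form is `dz` of the fine linear function, `AffineReproduction.dz_linear`; an2's `axProjBmAt_dz` gives `dz` of its block mean, §1; the additive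
constant `(N−1)∕2·Σ c` dies under `dz`). -/
theorem axProjBmAt_const_eq_dz (ρ : Fin (d + 1) → ℤ) (hN : 1 ≤ N) (c : Fin (d + 1) → ℝ) :
    axProjBmAt ρ N (fun κ _ => c κ) = dz (fun x : Site (d + 1) => (N : ℝ) * ∑ α, (blk N x α : ℝ) * c α) := by
  have hlin : (fun κ (_ : Site (d + 1)) => c κ) = dz (fun x : Site (d + 1) => ∑ α, (x α : ℝ) * c α) := by
    rw [dz_linear]; rfl
  rw [hlin, axProjBmAt_dz ρ hN]
  have hbm : blockMeanAt N (fun x : Site (d + 1) => ∑ α, (x α : ℝ) * c α)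
      = (fun x : Site (d + 1) => (N : ℝ) * ∑ α, (blk N x α : ℝ) * c α) + fun _ => (((N : ℝ) - 1) / 2) * ∑ α, c α := by
    funext x
    rw [Pi.add_apply, blockMeanAt_linear hN]
    simp only [add_mul, Finset.sum_add_distrib, mul_assoc, ← Finset.mul_sum]
  rw [hbm, dz_add, dz_const, add_zero]

/-- [folklore] **`Π_bm` DOES NOT FIX CONSTANTS — IT RETURNS `N` TIMES THE FACE-CROSSING INDICATOR** (any root offset `ρ`, `1 ≤ N`):
`Π^ρ_bm (κ ↦ c κ) (κ, x) = N·c κ` if the bond `(κ, x)` crosses a `κ`-face of the `N`-blocks (`x_κ % N = N − 1`) and `0` otherwise. -/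
theorem axProjBmAt_const_apply (ρ : Fin (d + 1) → ℤ) (hN : 1 ≤ N) (c : Fin (d + 1) → ℝ) (κ : Fin (d + 1)) (x : Site (d + 1)) :
    axProjBmAt ρ N (fun κ _ => c κ) κ x = if x κ % (N : ℤ) = (N : ℤ) - 1 then (N : ℝ) * c κ else 0 := by
  rw [axProjBmAt_const_eq_dz ρ hN c]
  simp only [dz]
  rw [← mul_sub, ← Finset.sum_sub_distrib]
  have e : ∀ α : Fin (d + 1), (blk N (x + unitVec κ) α : ℝ) * c α - (blk N x α : ℝ) * c α
      = (if α = κ ∧ x κ % (N : ℤ) = (N : ℤ) - 1 then (1 : ℝ) else 0) * c α := by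
    intro α
    rw [blk_add_unitVec_apply hN x κ α]
    split_ifs <;> push_cast <;> ring
  rw [Finset.sum_congr rfl fun α _ => e α,
    Finset.sum_eq_single κ (fun α _ hα => by rw [if_neg (fun h => hα h.1), zero_mul]) (fun h => absurd (Finset.mem_univ κ) h)]
  by_cases hf : x κ % (N : ℤ) = (N : ℤ) - 1
  · rw [if_pos ⟨rfl, hf⟩, if_pos hf, one_mul]
  · rw [if_neg (fun h => hf h.2), if_neg hf, zero_mul, mul_zero]

/-- [folklore] `Π_bm` on a translation-invariant 1-form, as an identity of 1-forms. -/
theorem axProjBmAt_const (ρ : Fin (d + 1) → ℤ) (hN : 1 ≤ N) (c : Fin (d + 1) → ℝ) :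
    axProjBmAt ρ N (fun κ _ => c κ) = fun κ x => if x κ % (N : ℤ) = (N : ℤ) - 1 then (N : ℝ) * c κ else 0 :=
  funext fun κ => funext fun x => axProjBmAt_const_apply ρ hN c κ x

/-- [folklore] **THE WINDOW-MATRIX FORM** (in-block root `ρ = toSite r`): `coProjBmW ρ N (κ ↦ c κ) = (κ, x) ↦ if x_κ % N = N−1 then N·c κ else 0`
(gen 27's `axProjBmAt_eq_coProjBmW'`). -/
theorem coProjBmW_const (hN : 1 ≤ N) {r : Fin (d + 1) → ℕ} (hr : r ∈ box (d + 1) N) (c : Fin (d + 1) → ℝ) :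
    coProjBmW (toSite r) N (fun κ _ => c κ) = fun κ x => if x κ % (N : ℤ) = (N : ℤ) - 1 then (N : ℝ) * c κ else 0 := by
  rw [← axProjBmAt_eq_coProjBmW' hN hr, axProjBmAt_const _ hN]

end Constants

/-! ## §3 Row sums of the matrix of `Π_bm` -/

section Rows

variable {N : ℕ} {r : Fin (d + 1) → ℕ}

/-- [folklore] **WEIGHTED ROW SUMS OF THE MATRIX OF `Π_bm`** (in-block root): `Σ_{v ∈ cube} Σ_α pmBm ρ N β p α (p − v)·c α = [p_β % N = N−1]·N·c β`
(`coProjBmW_apply` read backwards + `coProjBmW_const`). -/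
theorem sum_cube_sum_pmBm_row (hN : 1 ≤ N) (hr : r ∈ box (d + 1) N) (c : Fin (d + 1) → ℝ) (β : Fin (d + 1)) (p : Site (d + 1)) :
    ∑ v ∈ cube (d + 1) N, ∑ α : Fin (d + 1), pmBm (toSite r) N β p α (p - v) * c α
      = if p β % (N : ℤ) = (N : ℤ) - 1 then (N : ℝ) * c β else 0 := by
  rw [show (∑ v ∈ cube (d + 1) N, ∑ α : Fin (d + 1), pmBm (toSite r) N β p α (p - v) * c α) = coProjBmW (toSite r) N (fun κ _ => c κ) β p
    from rfl, coProjBmW_const hN hr]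

/-- [folklore] **ROW SUMS OF THE MATRIX OF `Π_bm`, WINDOW FORM** (in-block root): `Σ_{v ∈ cube} pmBm ρ N β p α (p − v) = [β = α ∧ p_β % N = N−1]·N`. -/
theorem sum_cube_pmBm_row (hN : 1 ≤ N) (hr : r ∈ box (d + 1) N) (β : Fin (d + 1)) (p : Site (d + 1)) (α : Fin (d + 1)) :
    ∑ v ∈ cube (d + 1) N, pmBm (toSite r) N β p α (p - v) = if β = α ∧ p β % (N : ℤ) = (N : ℤ) - 1 then (N : ℝ) else 0 := by
  have h := sum_cube_sum_pmBm_row hN hr (fun κ => if κ = α then (1 : ℝ) else 0) β p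
  simp only [mul_ite, mul_one, mul_zero, Finset.sum_ite_eq', Finset.mem_univ, if_true] at h
  rw [h]
  by_cases hβ : β = α <;> by_cases hf : p β % (N : ℤ) = (N : ℤ) - 1 <;> simp [hβ, hf]

/-- [folklore] A row of the matrix of `Π_bm` is summable (it is carried by the window: `window_of_pmBm_ne_zero`). -/
theorem summable_pmBm_row (hN : 1 ≤ N) (hr : r ∈ box (d + 1) N) (β : Fin (d + 1)) (p : Site (d + 1)) (α : Fin (d + 1)) :
    Summable fun q => pmBm (toSite r) N β p α q := by
  refine summable_of_ne_finset_zero (s := (cube (d + 1) N).image fun v => p - v) fun q hq => ?_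
  by_contra h
  exact hq (Finset.mem_image.2 ⟨p - q, window_of_pmBm_ne_zero hN hr h, sub_sub_cancel p q⟩)

/-- [folklore] The window sum of a row IS its lattice sum. -/
theorem sum_cube_pmBm_row_eq_tsum (hN : 1 ≤ N) (hr : r ∈ box (d + 1) N) (β : Fin (d + 1)) (p : Site (d + 1)) (α : Fin (d + 1)) :
    ∑ v ∈ cube (d + 1) N, pmBm (toSite r) N β p α (p - v) = ∑' q, pmBm (toSite r) N β p α q := by
  symm
  rw [tsum_eq_sum (s := (cube (d + 1) N).image fun v => p - v) fun q hq => ?_, Finset.sum_image fun v _ w _ h => sub_right_injective h]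
  by_contra h
  exact hq (Finset.mem_image.2 ⟨p - q, window_of_pmBm_ne_zero hN hr h, sub_sub_cancel p q⟩)

/-- [folklore] **THE ROW SUMS OF THE MATRIX OF `Π_bm`** (in-block root): `Σ'_q pmBm ρ N β p α q = [β = α ∧ p_β % N = N−1]·N` — contrast the Kronecker
COLUMN sums `SrecChargeBm.tsum_pmBm_col` (`Πᵀ_bm` fixes constants, `Π_bm` does not). -/
theorem tsum_pmBm_row (hN : 1 ≤ N) (hr : r ∈ box (d + 1) N) (β : Fin (d + 1)) (p : Site (d + 1)) (α : Fin (d + 1)) :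
    ∑' q, pmBm (toSite r) N β p α q = if β = α ∧ p β % (N : ℤ) = (N : ℤ) - 1 then (N : ℝ) else 0 := by
  rw [← sum_cube_pmBm_row_eq_tsum hN hr, sum_cube_pmBm_row hN hr]

/-- [folklore] **THE TRANSPOSED READ-OUT** (in-block root): summing the window of a fixed COLUMN direction `α` against weights on the ROW direction,
`Σ_{v ∈ cube} Σ_{α′} pmBm ρ N α′ x α (x − v)·g α′ = [x_α % N = N−1]·N·g α` (the bond `(α, x − v)` is read by the rows `(α′, x)`; only `α′ = α` survives). -/
theorem sum_cube_sum_pmBm_col_mul (hN : 1 ≤ N) (hr : r ∈ box (d + 1) N) (g : Fin (d + 1) → ℝ) (x : Site (d + 1)) (α : Fin (d + 1)) :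
    ∑ v ∈ cube (d + 1) N, ∑ α' : Fin (d + 1), pmBm (toSite r) N α' x α (x - v) * g α'
      = if x α % (N : ℤ) = (N : ℤ) - 1 then (N : ℝ) * g α else 0 := by
  rw [Finset.sum_comm]
  simp_rw [← Finset.sum_mul, sum_cube_pmBm_row hN hr]
  rw [Finset.sum_eq_single α (fun α' _ hα' => by rw [if_neg (fun h => hα' h.1), zero_mul]) (fun h => absurd (Finset.mem_univ α) h)]
  by_cases hf : x α % (N : ℤ) = (N : ℤ) - 1
  · rw [if_pos ⟨rfl, hf⟩, if_pos hf]
  · rw [if_neg (fun h => hf h.2), if_neg hf, zero_mul]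

end Rows

/-! ## §4 The field–field double-leg total of a block-mean dressed table -/

section Dressed

variable {N : ℕ} {r : Fin (d + 1) → ℕ}

/-- [folklore] **THE WINDOW FORM OF `Πᵀ X Π` ON FIELD LEGS**: `dressKBmAt ρ N X x z (inl α) (inl β) =
Σ_{w ∈ cube} Σ_{β′} Σ_{v ∈ cube} Σ_{α′} pmBm ρ N β′ (z+w) β z · (pmBm ρ N α′ (x+v) α x · X (x+v) (z+w) (inl α′) (inl β′))`
(an2's `dressKBmAt_eq_legs` with the two leg dressings unfolded through `coProjBmAt_apply`). -/
theorem dressKBmAt_inl_inl_eq_sum (ρ : Fin (d + 1) → ℤ) (N : ℕ) (X : MKer (d + 1) (Fib d)) (x z : Site (d + 1)) (α β : Fin (d + 1)) :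
    dressKBmAt ρ N X x z (Sum.inl α) (Sum.inl β) = ∑ w ∈ cube (d + 1) N, ∑ β' : Fin (d + 1), ∑ v ∈ cube (d + 1) N, ∑ α' : Fin (d + 1),
      pmBm ρ N β' (z + w) β z * (pmBm ρ N α' (x + v) α x * X (x + v) (z + w) (Sum.inl α') (Sum.inl β')) := by
  rw [dressKBmAt_eq_legs, legCo₂BmAt_inl, coProjBmAt_apply]
  refine Finset.sum_congr rfl fun w _ => Finset.sum_congr rfl fun β' _ => ?_
  rw [legCo₁BmAt_inl, coProjBmAt_apply, Finset.mul_sum]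
  refine Finset.sum_congr rfl fun v _ => ?_
  rw [Finset.mul_sum]

/-- [folklore] Two bounded factors times a summable one is summable (the shape of every window term below; `|pmBm| ≤ 1 + 4(d+1)N`). -/
theorem summable_bdd_mul_bdd_mul {ι : Type*} {Y a b : ι → ℝ} (hY : Summable Y) {B : ℝ} (ha : ∀ i, |a i| ≤ B) (hb : ∀ i, |b i| ≤ B) :
    Summable fun i => a i * (b i * Y i) := by
  refine Summable.of_norm_bounded ((hY.abs.mul_left B).mul_left B) fun i => ?_
  have hB0 : 0 ≤ B := (abs_nonneg _).trans (ha i)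
  rw [Real.norm_eq_abs, abs_mul, abs_mul]
  exact mul_le_mul (ha i) (mul_le_mul (hb i) le_rfl (abs_nonneg _) hB0) (by positivity) hB0

/-- [folklore] Fubini for the window-indexed finite family against the pair series: finite sums out of `Σ'`. -/
theorem tsum_sum_window {ι κ τ : Type*} (s : Finset ι) (t : Finset κ) {F : ι → Fin (d + 1) → κ → Fin (d + 1) → τ → ℝ}
    (hF : ∀ w β' v α', Summable (F w β' v α')) :
    ∑' p, ∑ w ∈ s, ∑ β' : Fin (d + 1), ∑ v ∈ t, ∑ α' : Fin (d + 1), F w β' v α' p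
      = ∑ w ∈ s, ∑ β' : Fin (d + 1), ∑ v ∈ t, ∑ α' : Fin (d + 1), ∑' p, F w β' v α' p := by
  rw [Summable.tsum_finsetSum fun w _ => summable_sum fun β' _ => summable_sum fun v _ => summable_sum fun α' _ => hF w β' v α']
  refine Finset.sum_congr rfl fun w _ => ?_
  rw [Summable.tsum_finsetSum fun β' _ => summable_sum fun v _ => summable_sum fun α' _ => hF w β' v α']
  refine Finset.sum_congr rfl fun β' _ => ?_
  rw [Summable.tsum_finsetSum fun v _ => summable_sum fun α' _ => hF w β' v α']
  refine Finset.sum_congr rfl fun v _ => ?_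
  rw [Summable.tsum_finsetSum fun α' _ => hF w β' v α']

/-- [folklore] The window read-out at one bond pair: `Σ_{w} Σ_{β′} Σ_{v} Σ_{α′} pmBm ρ N β′ z β (z−w)·(pmBm ρ N α′ x α (x−v)·X x z (inl α′)(inl β′))
= N²·[x_α % N = N−1 ∧ z_β % N = N−1]·X x z (inl α)(inl β)` (§3 `sum_cube_sum_pmBm_col_mul` on each leg). -/
theorem sum_window_pmBm_pmBm (hN : 1 ≤ N) (hr : r ∈ box (d + 1) N) (X : MKer (d + 1) (Fib d)) (x z : Site (d + 1)) (α β : Fin (d + 1)) :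
    ∑ w ∈ cube (d + 1) N, ∑ β' : Fin (d + 1), ∑ v ∈ cube (d + 1) N, ∑ α' : Fin (d + 1),
        pmBm (toSite r) N β' z β (z - w) * (pmBm (toSite r) N α' x α (x - v) * X x z (Sum.inl α') (Sum.inl β'))
      = (N : ℝ) ^ 2 * (if x α % (N : ℤ) = (N : ℤ) - 1 ∧ z β % (N : ℤ) = (N : ℤ) - 1 then X x z (Sum.inl α) (Sum.inl β) else 0) := by
  have e1 : ∀ (w : Site (d + 1)) (β' : Fin (d + 1)),
      ∑ v ∈ cube (d + 1) N, ∑ α' : Fin (d + 1), pmBm (toSite r) N β' z β (z - w) * (pmBm (toSite r) N α' x α (x - v) * X x z (Sum.inl α') (Sum.inl β'))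
        = pmBm (toSite r) N β' z β (z - w) * (if x α % (N : ℤ) = (N : ℤ) - 1 then (N : ℝ) * X x z (Sum.inl α) (Sum.inl β') else 0) := by
    intro w β'
    simp only [← Finset.mul_sum]
    rw [sum_cube_sum_pmBm_col_mul hN hr (fun α' => X x z (Sum.inl α') (Sum.inl β')) x α]
  simp only [e1]
  rw [sum_cube_sum_pmBm_col_mul hN hr (fun β' => if x α % (N : ℤ) = (N : ℤ) - 1 then (N : ℝ) * X x z (Sum.inl α) (Sum.inl β') else 0) z β]
  by_cases hz : z β % (N : ℤ) = (N : ℤ) - 1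
  · rw [if_pos hz]
    by_cases hx : x α % (N : ℤ) = (N : ℤ) - 1
    · rw [if_pos hx, if_pos ⟨hx, hz⟩]; ring
    · rw [if_neg hx, if_neg (fun h => hx h.1), mul_zero, mul_zero]
  · rw [if_neg hz, if_neg (fun h => hz h.2), mul_zero]

/-- [folklore] **THE FIELD–FIELD ENTRIES OF A DRESSED TABLE ARE SUMMABLE OVER THE BOND PAIR** (in-block root; table with summable field–field pair sums). -/
theorem summable_prod_dressKBmAt_inl_inl (hN : 1 ≤ N) (hr : r ∈ box (d + 1) N) {X : MKer (d + 1) (Fib d)}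
    (hX : ∀ α' β' : Fin (d + 1), Summable fun xz : Site (d + 1) × Site (d + 1) => X xz.1 xz.2 (Sum.inl α') (Sum.inl β'))
    (α β : Fin (d + 1)) :
    Summable fun xz : Site (d + 1) × Site (d + 1) => dressKBmAt (toSite r) N X xz.1 xz.2 (Sum.inl α) (Sum.inl β) := by
  have e : (fun xz : Site (d + 1) × Site (d + 1) => dressKBmAt (toSite r) N X xz.1 xz.2 (Sum.inl α) (Sum.inl β))
      = fun xz => ∑ w ∈ cube (d + 1) N, ∑ β' : Fin (d + 1), ∑ v ∈ cube (d + 1) N, ∑ α' : Fin (d + 1),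
          pmBm (toSite r) N β' (xz.2 + w) β xz.2 * (pmBm (toSite r) N α' (xz.1 + v) α xz.1 * X (xz.1 + v) (xz.2 + w) (Sum.inl α') (Sum.inl β')) :=
    funext fun xz => dressKBmAt_inl_inl_eq_sum (toSite r) N X xz.1 xz.2 α β
  rw [e]
  exact summable_sum fun w _ => summable_sum fun β' _ => summable_sum fun v _ => summable_sum fun α' _ =>
    summable_bdd_mul_bdd_mul ((Equiv.prodCongr (Equiv.addRight v) (Equiv.addRight w)).summable_iff.2 (hX α' β'))
      (fun xz => abs_pmBm_le hN hr β' (xz.2 + w) β xz.2) (fun xz => abs_pmBm_le hN hr α' (xz.1 + v) α xz.1)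

/-- [folklore] **THE FIELD–FIELD DOUBLE-LEG TOTAL OF A BLOCK-MEAN DRESSED TABLE** (in-block root `ρ = toSite r`, `1 ≤ N`; `X` with summable field–field
pair sums): `Σ'_{(x,z)} dressKBmAt ρ N X x z (inl α) (inl β) = N²·Σ'_{(x,z)} [x_α % N = N−1 ∧ z_β % N = N−1]·X x z (inl α) (inl β)` — as a bilinear form
`(Πᵀ X Π)[1_α, 1_β] = X[Π 1_α, Π 1_β]` and `Π 1_α = N·𝟙[α-bonds crossing an α-face]` (§2): the dressing does NOT preserve the double-leg total.
Proof: window form (`dressKBmAt_inl_inl_eq_sum`), finite sums out of the pair series, one lattice shift `(x, z) ↦ (x − v, z − w)` per window offset,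
finite sums back in, and the row read-out `sum_window_pmBm_pmBm`. -/
theorem tsum_prod_dressKBmAt_inl_inl (hN : 1 ≤ N) (hr : r ∈ box (d + 1) N) {X : MKer (d + 1) (Fib d)}
    (hX : ∀ α' β' : Fin (d + 1), Summable fun xz : Site (d + 1) × Site (d + 1) => X xz.1 xz.2 (Sum.inl α') (Sum.inl β'))
    (α β : Fin (d + 1)) :
    ∑' xz : Site (d + 1) × Site (d + 1), dressKBmAt (toSite r) N X xz.1 xz.2 (Sum.inl α) (Sum.inl β)
      = (N : ℝ) ^ 2 * ∑' xz : Site (d + 1) × Site (d + 1),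
          (if xz.1 α % (N : ℤ) = (N : ℤ) - 1 ∧ xz.2 β % (N : ℤ) = (N : ℤ) - 1 then X xz.1 xz.2 (Sum.inl α) (Sum.inl β) else 0) := by
  -- the window terms before the shift are summable (bounded `pmBm`'s, shifted table) …
  have hT : ∀ (w : Site (d + 1)) (β' : Fin (d + 1)) (v : Site (d + 1)) (α' : Fin (d + 1)),
      Summable fun xz : Site (d + 1) × Site (d + 1) =>
        pmBm (toSite r) N β' (xz.2 + w) β xz.2 * (pmBm (toSite r) N α' (xz.1 + v) α xz.1 * X (xz.1 + v) (xz.2 + w) (Sum.inl α') (Sum.inl β')) :=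
    fun w β' v α' => summable_bdd_mul_bdd_mul ((Equiv.prodCongr (Equiv.addRight v) (Equiv.addRight w)).summable_iff.2 (hX α' β'))
      (fun xz => abs_pmBm_le hN hr β' (xz.2 + w) β xz.2) (fun xz => abs_pmBm_le hN hr α' (xz.1 + v) α xz.1)
  -- … and so are the ones after it (unshifted table)
  have hT' : ∀ (w : Site (d + 1)) (β' : Fin (d + 1)) (v : Site (d + 1)) (α' : Fin (d + 1)),
      Summable fun xz : Site (d + 1) × Site (d + 1) =>
        pmBm (toSite r) N β' xz.2 β (xz.2 - w) * (pmBm (toSite r) N α' xz.1 α (xz.1 - v) * X xz.1 xz.2 (Sum.inl α') (Sum.inl β')) :=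
    fun w β' v α' => summable_bdd_mul_bdd_mul (hX α' β')
      (fun xz => abs_pmBm_le hN hr β' xz.2 β (xz.2 - w)) (fun xz => abs_pmBm_le hN hr α' xz.1 α (xz.1 - v))
  -- the shift, one window offset at a time
  have hshift : ∀ (w : Site (d + 1)) (β' : Fin (d + 1)) (v : Site (d + 1)) (α' : Fin (d + 1)),
      ∑' xz : Site (d + 1) × Site (d + 1), pmBm (toSite r) N β' (xz.2 + w) β xz.2 *
          (pmBm (toSite r) N α' (xz.1 + v) α xz.1 * X (xz.1 + v) (xz.2 + w) (Sum.inl α') (Sum.inl β'))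
        = ∑' xz : Site (d + 1) × Site (d + 1), pmBm (toSite r) N β' xz.2 β (xz.2 - w) *
          (pmBm (toSite r) N α' xz.1 α (xz.1 - v) * X xz.1 xz.2 (Sum.inl α') (Sum.inl β')) := by
    intro w β' v α'
    rw [← (Equiv.prodCongr (Equiv.addRight v) (Equiv.addRight w)).tsum_eq (fun xz : Site (d + 1) × Site (d + 1) =>
      pmBm (toSite r) N β' xz.2 β (xz.2 - w) * (pmBm (toSite r) N α' xz.1 α (xz.1 - v) * X xz.1 xz.2 (Sum.inl α') (Sum.inl β')))]
    refine tsum_congr fun xz => ?_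
    simp only [Equiv.prodCongr_apply, Prod.map_fst, Prod.map_snd, Equiv.coe_addRight, add_sub_cancel_right]
  have e1 : ∑' xz : Site (d + 1) × Site (d + 1), dressKBmAt (toSite r) N X xz.1 xz.2 (Sum.inl α) (Sum.inl β)
      = ∑' xz : Site (d + 1) × Site (d + 1), ∑ w ∈ cube (d + 1) N, ∑ β' : Fin (d + 1), ∑ v ∈ cube (d + 1) N, ∑ α' : Fin (d + 1),
          pmBm (toSite r) N β' (xz.2 + w) β xz.2 * (pmBm (toSite r) N α' (xz.1 + v) α xz.1 * X (xz.1 + v) (xz.2 + w) (Sum.inl α') (Sum.inl β')) :=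
    tsum_congr fun xz => dressKBmAt_inl_inl_eq_sum (toSite r) N X xz.1 xz.2 α β
  rw [e1, tsum_sum_window _ _ hT]
  simp only [hshift]
  rw [← tsum_sum_window _ _ hT', ← tsum_mul_left]
  exact tsum_congr fun xz => sum_window_pmBm_pmBm hN hr X xz.1 xz.2 α β

/-- [folklore] **THE `BiLoc` INSTANCE** (the form of RULINGS-16 (R16-1)): for a table bi-localised at rate `δ > 0` (leaf-06's `summable_prod_of_biLoc`
feeds `hX`; the same term feeds `summable_prod_dressKBmAt_inl_inl`),
`Σ'_{(x,z)} dressKBmAt ρ N X x z (inl α) (inl β) = N²·Σ'_{(x,z)} [x_α % N = N−1 ∧ z_β % N = N−1]·X x z (inl α) (inl β)`. -/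
theorem tsum_prod_dressKBmAt_inl_inl_of_biLoc (hN : 1 ≤ N) (hr : r ∈ box (d + 1) N) {X : MKer (d + 1) (Fib d)} {x₀ z₀ : Site (d + 1)}
    {C δ : ℝ} (hX : BiLoc X x₀ z₀ C δ) (hδ : 0 < δ) (α β : Fin (d + 1)) :
    ∑' xz : Site (d + 1) × Site (d + 1), dressKBmAt (toSite r) N X xz.1 xz.2 (Sum.inl α) (Sum.inl β)
      = (N : ℝ) ^ 2 * ∑' xz : Site (d + 1) × Site (d + 1),
          (if xz.1 α % (N : ℤ) = (N : ℤ) - 1 ∧ xz.2 β % (N : ℤ) = (N : ℤ) - 1 then X xz.1 xz.2 (Sum.inl α) (Sum.inl β) else 0) :=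
  tsum_prod_dressKBmAt_inl_inl hN hr (fun α' β' => summable_prod_of_biLoc hX hδ (Sum.inl α') (Sum.inl β')) α β

end Dressed

end Summit.QuantumFields.BalabanUV.Beta.GAN24.PiBmConstants

end
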